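import Summits.Ventures.HSemireg.Pad4FirstOrderModel

/-!
# Venture HSemireg — PAD-4 on the balanced alphabet 𝔅(μ₄): the support D_ML8 = ML8^G generated in Lean, and the
# SUPPORT FACTS used by THEOREM L-lite (bc5-plan g3) as kernel certificates

HONEST FRAMING. Lean index of the computation cell `pub-hsemireg` (S4-PUSH, H2 door PAD-4), typed by the Ventures-side
typer `hodge-lit-semireg-typer-2` (director-hodge g7 ROW SUPPLY, ladder REQUESTS l.11011 (4), cell INBOX l.30215): third
of the `Pad4Tower*` files — **THEOREM L-lite** of the №3 bc5-witness planner `hodge-bloch-bc5-plan` g3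
(`hodge-bloch-bc5-plan/BC5-PLAN-g3-MEMO.md` §7, v1.2–v2.4; pencil; referee ×2 PASS s4-ref-2 g8 95cb4a4d9e67ff90 for the
D_ML8 theorem, the general COROLLARY «L-lite schema» ×1 with C1∕C2 folded (v1.7), §11 PREDICTION on D_T1 ×1).

THEOREM L-lite (D_ML8), AS PRINTED (memo §7): «Every two-level ⊕-block design with supp ⊆ supp N ∪ supp P [of D_ML8 =
ML8^G] (any multiplicities, any sections) that contains a fully charged constituent violates (H2).» Its proof is a
first-order argument in the 𝔅-alphabet (demand (L1) at (σ,f), two clean (R2)-rows, a unipotent change of splitting of `E₊`,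
and an `E₊`-side diagonal kill at the re-split summand `Q̃`). **THE CONCLUSION «violates (H2)» IS NOT STATED IN LEAN**: the
tree's first-order model (FILE A `Pad4FirstOrderModel`, p505821) is the class-y model — one apex per constituent — and
D_ML8's constituents `[O|ℓ|ℓ|2I]`, `[O|O|2I|2I]`, `[O|O|ℓ|2I]` carry the node `2I` (a second apex); no 𝔅-model exists and
none is axiomatised here. What IS typed: the alphabet, the support, the hypothesis side, and — as `decide` certificates over
the Lean-generated support — EXACTLY THE SUPPORT FACTS THE ×2'd PROOF READS (memo §7 «WHAT IS AND IS NOT USED. Used: the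
support (order O < ℓ < 2I, «below ℓ only O», «between ℓ_ζ and 2I nothing», «no N with two 2I's and one ℓ», «no P with one
O and a 2I») …»), in the precise forms in which steps (1), (3), (4), (6) use them.

THE ALPHABET (PAD4-BALANCED §0; memo §0, §7 SETTING). A factor point is a balanced block `x = (α, β) ∈ ℤ ⊕ ℤ[i]`, entered
as `(α, Re β, Im β) ∈ ℤ³`; letters `O = (0,0)`, `ℓ_ζ = (1, ζ̄)` (`ζ = i^k ∈ μ₄`; so `ℓ_1 = (1,1)`, `ℓ_i = (1,−i)`, …),
`2I = (2,0)`. A difference `Δ` is EFFECTIVE («future-causal or 0») iff `Δα ≥ 0` and `|Δβ|² ≤ Δα²`; `P ≤ X` letterwise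
(«`φ_{XP} ≠ 0` possible», a PARTNER∕participant) iff `X − P` is effective on every factor. (Same encoding as bc5-plan's
`Pad4NoClosedTripleService` draft 9a34a166ac37406f: `x Z f : ℤ × ℤ[i]`.) SEAM TO FILE A: a class-y constituent
`t·h + Σ c_f ℓ_{ζ_f}` has `x_f = (t + c_f, c_f ζ̄_f)` — `BCell.ofConstituent` (uses FILE A's `Constituent.beta`).

CONTENT.
* §1 `BPoint`, `Effective` (the 𝔅 geometry); `bpointOfConstituent` (seam to FILE A); the six letters as an inductive type
  `Letter` (`O`, `l0…l3 = ℓ_{i^k}`, `I2 = 2I`) with `Letter.pt` (their balanced points) and the ORDER TABLE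
  `Letter.le` — PROVED equal to the geometry (`Letter.le_iff_effective`: `a ≼ b ⟺ pt b − pt a` effective; `O < ℓ_ζ < 2I`,
  distinct `ℓ`'s incomparable); letter cells `LCell` (a record of four letters, for fast kernel evaluation), `get`∕`set`,
  `LCell.le` (letterwise `≤`), `isFC`, `count`, `phaseParity`.
* §2 the support **D_ML8 = ML8^G** (gs-eng-2 g48; s4-search-1 `kitds/D_ML8.json`; memo §7 SETTING) GENERATED IN LEAN by
  filtering the `6⁴` letter cells on letter counts: `suppN` = `[O|O|2I|2I]₆ ∪ [O|ℓ|ℓ|2I]₁₉₂ ∪ [ℓℓℓℓ]₁₂₈ (Πζ = ±1 ⟺ Σk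
  even)`, `suppP` = `[O|O|ℓ|2I]₄₈ ∪ [O|ℓ|ℓ|ℓ]₂₅₆`; certificate `supp_cards` (326 = 6 + 192 + 128, 304 = 48 + 256, 128 FC).
  (This typer checked offline that the generated support EQUALS the json class-for-class, 630∕630, letter `1+k` ↦ `(1, ζ̄)`
  with `ζ = i^k` matching the json's `(α, Re β, Im β)`.)
* §3 the hypothesis side of THEOREM L-lite as a predicate on finite 𝔅-designs: `LliteHypothesisDML8 lower upper` :=
  `lower ⊆ suppN ∧ upper ⊆ suppP ∧ some constituent is fully charged` (multiplicities∕sections play no role; (H1) ⇒ the FC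
  constituent, FILE A `exists_fullyCharged_of_H1` on the class-y slice ∕ memo §0).
* §4 **THE SUPPORT FACTS OF THE PROOF, `decide`d over the generated support** (for EVERY fully charged `X ∈ suppN`, every
  factor `a`, every `τ ≠ a`): (F1) step (1) PARTNERS — the `P ≤ X` are EXACTLY the four own cancellations `Q₀^{(g)} = X(g → O)`
  (so `X` has no (r2a)∕(r2b) partner and its `σ`-legs are copies of ONE class); (F3) step (3) WHO SITS ABOVE `Q₀ = [O ℓ ℓ ℓ]`
  (quantified over ALL 256 such `P`-classes, which are exactly the own cancellations) — the `N ≥ Q₀` are EXACTLY the `a`-flags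
  in `supp N` (two phases `±ζ_a`) and the three antipodal servers `R_m = Q₀(m → 2I)`, and the only `P ≥ Q₀` is `Q₀` (no
  companions for the change of splitting); (F4) step (4) ROW PARTICIPANTS (over ALL 192 rows `R = [O ℓ ℓ 2I]`) — the `P ≤ R`
  are EXACTLY the four siblings `R(τ → ℓ_v)` (`Q₀` and the cross-phase `P′`) and `R(g → O)` for the two letter factors
  (`P″`, `P‴`); (F6) step (6) — `[O|2I|2I|ℓ] ∉ supp N` (with (F3): no `b`-∕`p`-leg carriers other than `R_b`, `R_p`, and no
  (r2a)-neighbour of `Q̃` on the spare pair).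

WHAT IS NOT HERE. The proof steps (2), (5), (6) themselves (LEAK kind table, `U ≅ ℂ`, the re-splitting `A ∈ Aut(E₊)`,
THEOREM P (b) at `Q̃`), the conclusion ¬(H2), the general L-lite SCHEMA ∕ RIND LEMMA ∕ THEOREM FC1 (memo §7 COROLLARY, §12,
§13 — ×1 or partly ×2; hypotheses phase- and direction-dependent, not typed), the §11 D_T1 prediction, leak9. Nothing is a
statement about a variety, a sheaf, `σ`, a seed or an abelian variety; NOTHING HERE SAYS THAT HC ∕ HC_CM ∕ HC_AV ∕ W₆ ∕
HC_Kum4Type HOLDS OR FAILS. No `instance`, no notation, no named fact, 0 `sorry`; axioms standard; `decide +kernel` only.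

SOURCES (sha16): BC5-PLAN-g3-MEMO.md v2.4 (cell copy `hodge-bloch-bc5-plan/BC5-PLAN-g3-MEMO.md`; §0, §7 THEOREM L-lite +
PROOF (1)–(6) + «WHAT IS AND IS NOT USED», PRECISION P2∕P3; v1.9 frozen twin 84930e66d6ada6d9); s4-ref-2 g8 verdict
95cb4a4d9e67ff90 (`s4push/VERDICT-BC5-PLAN-G3-MEMO-V1-4-…-S4-REF-2-G8-2026-08-27.md`); PAD4-BALANCED-search-1.md v1.6
e2d93ac598b3704c §0; s4-search-1 g20 `code/g20/pad4/kitds/D_ML8.json` (630 classes); gs-eng-2 g48 XCHECK-F1W (ML8^G); FILE A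
b6b3015efa20709e (p505821).
-/

namespace Summit.Ventures.HSemireg.Pad4Tower

open Finset Summit.Ventures.HSemireg.Pad4FirstOrder

/-! ## §1 The balanced alphabet 𝔅(μ₄) and the six letters of D_ML8 -/

/-- a factor point `(α, Re β, Im β)` of the balanced lattice `ℤ ⊕ ℤ[i]` (block `[[α, β], [β̄, α]]`). -/
abbrev BPoint := ℤ × ℤ × ℤ

/-- a difference `(Δα, ΔRe β, ΔIm β)` is EFFECTIVE (future-causal or zero): `Δα ≥ 0` and `|Δβ|² ≤ Δα²`. -/
abbrev Effective (Δ : BPoint) : Prop := 0 ≤ Δ.1 ∧ Δ.2.1 ^ 2 + Δ.2.2 ^ 2 ≤ Δ.1 ^ 2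

/-- componentwise difference of factor points. -/
abbrev bsub (x y : BPoint) : BPoint := (x.1 - y.1, x.2.1 - y.2.1, x.2.2 - y.2.2)

/-- SEAM TO FILE A: the balanced factor point of a class-y constituent `t·h + Σ_f c_f ℓ_{ζ_f}` on factor `f`:
`x_f = (t + c_f, c_f ζ̄_f)` (PAD4-BALANCED §0: `β = c ζ̄`, `t = α − |β|`; FILE A `Constituent.beta`). -/
def bpointOfConstituent (X : Constituent) (f : Fin 4) : BPoint :=
  (X.layer + X.charge f, (X.beta f).re, (X.beta f).im)

/-- the SIX LETTERS of D_ML8's alphabet: `O`, `ℓ_ζ` for `ζ = i^k` (`l0, l1, l2, l3` ↔ `k = 0,1,2,3`), and the node `2I`. -/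
inductive Letter where
  | O | l0 | l1 | l2 | l3 | I2
deriving DecidableEq, Repr

/-- the balanced factor point of a letter: `O = (0,0)`, `ℓ_ζ = (1, ζ̄)` (`k = 0,1,2,3 ↦ β = 1, −i, −1, i`), `2I = (2,0)`. -/
def Letter.pt : Letter → BPoint
  | .O => (0, 0, 0) | .l0 => (1, 1, 0) | .l1 => (1, 0, -1) | .l2 => (1, -1, 0) | .l3 => (1, 0, 1) | .I2 => (2, 0, 0)

/-- the phase index `k` of `ℓ_{i^k}` (`0` for `O` and `2I`, where it is not read). -/
def Letter.phase : Letter → ℕ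
  | .l1 => 1 | .l2 => 2 | .l3 => 3 | _ => 0

/-- all six letters. -/
def letters : List Letter := [.O, .l0, .l1, .l2, .l3, .I2]

/-- the letter ORDER `a ≼ b` :⇔ `b − a` effective, as a table: `O ≼` everything; `ℓ_ζ ≼ ℓ_ζ`, `ℓ_ζ ≼ 2I`; `2I ≼ 2I`;
distinct `ℓ`'s incomparable (memo §7 SETTING «O < ℓ_ζ < 2I, 2I − ℓ_ζ = ℓ_{−ζ}, ℓ_ζ ∥ ℓ_w»). -/
abbrev Letter.le (a b : Letter) : Prop := a = .O ∨ a = b ∨ b = .I2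

/-- **the table IS the geometry**: `a ≼ b` iff the balanced difference `pt b − pt a` is effective. [kernel, `decide`] -/
theorem Letter.le_iff_effective : ∀ a ∈ letters, ∀ b ∈ letters, Letter.le a b ↔ Effective (bsub b.pt a.pt) := by
  decide +kernel

/-- `letters` lists every letter (so the table above is exhaustive). -/
theorem Letter.mem_letters (a : Letter) : a ∈ letters := by cases a <;> decide

/-- a D_ML8 constituent: one letter per factor (a record, for fast kernel evaluation). -/
structure LCell where
  /-- letter on factor 0 -/
  x0 : Letter
  /-- letter on factor 1 -/
  x1 : Letter
  /-- letter on factor 2 -/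
  x2 : Letter
  /-- letter on factor 3 -/
  x3 : Letter
deriving DecidableEq, Repr

/-- the letter of `X` on factor `f`. -/
def LCell.get (X : LCell) (f : Fin 4) : Letter :=
  match f with
  | ⟨0, _⟩ => X.x0
  | ⟨1, _⟩ => X.x1
  | ⟨2, _⟩ => X.x2
  | ⟨3, _⟩ => X.x3

/-- `X` with the letter on factor `f` replaced by `a`. -/
def LCell.set (X : LCell) (f : Fin 4) (a : Letter) : LCell :=
  match f with
  | ⟨0, _⟩ => { X with x0 := a }
  | ⟨1, _⟩ => { X with x1 := a }
  | ⟨2, _⟩ => { X with x2 := a }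
  | ⟨3, _⟩ => { X with x3 := a }

/-- `P ≤ X` letterwise: `X − P` effective on every factor (an entry `P → X` can be non-zero; a PARTNER ∕ row participant). -/
abbrev LCell.le (P X : LCell) : Prop := P.x0.le X.x0 ∧ P.x1.le X.x1 ∧ P.x2.le X.x2 ∧ P.x3.le X.x3

/-- the letter is a unit null letter `ℓ_ζ`. -/
abbrev Letter.isEll (a : Letter) : Prop := a ≠ .O ∧ a ≠ .I2

/-- FULLY CHARGED: all four letters are `ℓ`'s. -/
abbrev LCell.isFC (X : LCell) : Prop := X.x0.isEll ∧ X.x1.isEll ∧ X.x2.isEll ∧ X.x3.isEll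

/-- number of factors carrying the letter `a`. -/
def LCell.count (X : LCell) (a : Letter) : ℕ :=
  (if X.x0 = a then 1 else 0) + (if X.x1 = a then 1 else 0) + (if X.x2 = a then 1 else 0) + (if X.x3 = a then 1 else 0)

/-- the phase-index sum `Σ k_f` mod 2 (`Πζ = i^{Σk} = ±1 ⟺` even). -/
def LCell.phaseParity (X : LCell) : ℕ := (X.x0.phase + X.x1.phase + X.x2.phase + X.x3.phase) % 2

/-! ## §2 The support D_ML8 = ML8^G, generated -/

/-- all `6⁴ = 1296` letter cells. -/
def allCells : List LCell :=
  letters.flatMap fun a => letters.flatMap fun b => letters.flatMap fun c => letters.map fun d => ⟨a, b, c, d⟩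

/-- the letter-count description of `supp N` of D_ML8: `[O|O|2I|2I]`, `[O|ℓ|ℓ|2I]`, or `[ℓℓℓℓ]` with `Σk` even. -/
abbrev LCell.shapeN (X : LCell) : Prop :=
  (X.count .O = 2 ∧ X.count .I2 = 2) ∨ (X.count .O = 1 ∧ X.count .I2 = 1) ∨
    (X.count .O = 0 ∧ X.count .I2 = 0 ∧ X.phaseParity = 0)

/-- the letter-count description of `supp P` of D_ML8: `[O|O|ℓ|2I]` or `[O|ℓ|ℓ|ℓ]`. -/
abbrev LCell.shapeP (X : LCell) : Prop := (X.count .O = 2 ∧ X.count .I2 = 1) ∨ (X.count .O = 1 ∧ X.count .I2 = 0)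

/-- **supp N of D_ML8 = ML8^G** (memo §7 SETTING; gs-eng-2 g48; s4-search-1 `kitds/D_ML8.json`): `[O|O|2I|2I]` (6) ∪
`[O|ℓ|ℓ|2I]` (192) ∪ `[ℓℓℓℓ]` with `Πζ = ±1`, i.e. `Σk` even (128). -/
def suppN : List LCell := allCells.filter fun X => X.shapeN

/-- **supp P of D_ML8**: `[O|O|ℓ|2I]` (48) ∪ `[O|ℓ|ℓ|ℓ]` (256). -/
def suppP : List LCell := allCells.filter fun X => X.shapeP

/-- 326 `N`-classes (6 + 192 + 128), 304 `P`-classes (48 + 256), 128 fully charged `N`, no fully charged `P`.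
[kernel, `decide`] -/
theorem supp_cards :
    suppN.length = 326 ∧ suppP.length = 304 ∧
      (suppN.filter fun X => X.count .O = 2).length = 6 ∧ (suppN.filter fun X => X.count .O = 1).length = 192 ∧
      (suppN.filter fun X => X.isFC).length = 128 ∧ (suppP.filter fun X => X.count .I2 = 1).length = 48 ∧
      (suppP.filter fun X => X.isFC).length = 0 := by
  decide +kernel

/-! ## §3 The hypothesis side of THEOREM L-lite -/

/-- **the hypothesis of THEOREM L-lite (D_ML8)** on a finite two-level design given by its class lists: support inside D_ML8
and some fully charged constituent present ((H1) forces one: memo §0; FILE A `exists_fullyCharged_of_H1` on the class-y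
slice). Multiplicities and sections are irrelevant to the printed statement, whose CONCLUSION «the design violates (H2)»
is NOT a Lean statement (module docstring). -/
def LliteHypothesisDML8 (lower upper : List LCell) : Prop :=
  (∀ X ∈ lower, X ∈ suppN) ∧ (∀ X ∈ upper, X ∈ suppP) ∧ ∃ X ∈ lower ++ upper, X.isFC

/-! ## §4 The support facts read by the proof of THEOREM L-lite (memo §7 (1), (3), (4), (6))

The support and the letter order are invariant under relabelling the four factors (`supp_swap_invariant` below certifies the
three generating transpositions). (F1) and (F6) are checked over the WHOLE support; (F3) and (F4) — the statements quantifying over pairs of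
classes with a distinguished factor — are checked for the factor position `a = 0` (and `τ = 1`),
the other positions being their images under the certified relabelling symmetry (that transport is a one-line pencil step,
not a Lean proof: flagged). -/

/-- swap the letters on factors `0` and `f`. -/
def LCell.swap0 (X : LCell) (f : Fin 4) : LCell :=
  match f with
  | ⟨0, _⟩ => X
  | ⟨1, _⟩ => ⟨X.x1, X.x0, X.x2, X.x3⟩
  | ⟨2, _⟩ => ⟨X.x2, X.x1, X.x0, X.x3⟩
  | ⟨3, _⟩ => ⟨X.x3, X.x1, X.x2, X.x0⟩

/-- **relabelling symmetry**: the shape predicates cutting `supp N = allCells.filter shapeN` and `supp P` out of all letter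
cells are invariant under the transpositions `(0 f)` (which generate `S₄`); the letterwise order commutes with relabelling
by definition. [kernel, `decide`] -/
theorem supp_swap_invariant :
    ∀ f : Fin 4, ∀ X ∈ allCells, (X.shapeN ↔ (X.swap0 f).shapeN) ∧ (X.shapeP ↔ (X.swap0 f).shapeP) := by
  decide +kernel

/-- **(F1) = step (1) PARTNERS.** For every fully charged `X ∈ supp N`, the `P`-classes `≤ X` letterwise are EXACTLY the four
own cancellations `Q₀^{(g)} = X(g → O)` («below `ℓ` the alphabet has only `O`»; no `P` with two `O`'s lies below `X`); so `X`
has no (r2a)∕(r2b) partner and its pure `g`-legs are copies of ONE class. [kernel, `decide`] -/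
theorem llite_F1_partners :
    ∀ X ∈ suppN, X.isFC → ∀ P ∈ suppP, (P.le X ↔ ∃ g : Fin 4, P = X.set g .O) := by
  decide +kernel

/-- **(F3) = step (3), `P`-side** (factor position `a = 0`; other positions by `supp_swap_invariant`): the only `P`-class
`≥ Q₀ = [O ℓ ℓ ℓ]` is `Q₀` itself — a change of splitting at `Q₀` has no companions (`[O|O|ℓ|2I]` has two `O`'s).
[kernel, `decide`] -/
theorem llite_F3_aboveP_pos0 : ∀ Q ∈ suppP, Q.x0 = .O → Q.count .O = 1 → ∀ P ∈ suppP, (Q.le P ↔ P = Q) := by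
  decide +kernel

/-- **(F3) = step (3) WHO SITS ABOVE `Q₀`, `N`-side** (factor position `a = 0`; other positions by `supp_swap_invariant`):
for every `P`-class `Q₀ = [O ℓ ℓ ℓ]` with `O` on factor `0` (the own `0`-cancellations of the fully charged `X`'s), the
`N`-classes `≥ Q₀` are EXACTLY the `0`-FLAGS `Q₀(0 → ℓ_w)` lying in `supp N` (`Πζ = ±1`: two of the four `w`, for `X` the
phases `±ζ_0`) and the three antipodal SERVERS `R_m = Q₀(m → 2I)`, `m ≠ 0`. [kernel, `decide`] -/
theorem llite_F3_aboveN_pos0 :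
    ∀ Q ∈ suppP, Q.x0 = .O → Q.count .O = 1 → ∀ N' ∈ suppN,
      (Q.le N' ↔ (N'.x0.isEll ∧ N'.x1 = Q.x1 ∧ N'.x2 = Q.x2 ∧ N'.x3 = Q.x3) ∨
        ∃ m : Fin 4, m ≠ 0 ∧ N' = Q.set m .I2) := by
  decide +kernel

/-- **(F4) = step (4) ROW PARTICIPANTS** (positions `a = 0`, `τ = 1`; others by `supp_swap_invariant`): for every `N`-class
`R = [O 2I ℓ ℓ]` (the rows `R_τ = Q₀(τ → 2I)`), the `P`-classes `≤ R` are EXACTLY the four siblings `R(1 → ℓ_v)` (`Q₀` and the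
cross-phase `P′_{a,τ,v}`) and `R(2 → O) = P″`, `R(3 → O) = P‴`. [kernel, `decide`] -/
theorem llite_F4_rows_pos01 :
    ∀ R ∈ suppN, R.count .O = 1 → R.x0 = .O → R.x1 = .I2 → ∀ P ∈ suppP,
      (P.le R ↔ (P.x0 = .O ∧ P.x1.isEll ∧ P.x2 = R.x2 ∧ P.x3 = R.x3) ∨ P = R.set 2 .O ∨ P = R.set 3 .O) := by
  decide +kernel

/-- **(F6) = step (6).** No `N`-class has the shape `[O|2I|2I|ℓ]`: an `N`-class with two nodes has two `O`'s (the would-be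
(r2a)-neighbour of `Q̃` on the spare pair belongs to the mirror design `L₄^G`). [kernel, `decide`] -/
theorem llite_F6_no_O2I2Il : ∀ N' ∈ suppN, N'.count .I2 = 2 → N'.count .O = 2 := by
  decide +kernel

end Summit.Ventures.HSemireg.Pad4Tower
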